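import Mathlib.Combinatorics.SimpleGraph.Coloring.Vertex
import Mathlib.Algebra.Pointwise.Stabilizer
import Literature.Combinatorics.SimpleGraph.TreeAutomorphismFixedPoints   -- ★ `invertedEdges`, `mem_invertedEdges_iff`, `card_fixedVertices_eq_of_invertedEdges_eq_empty`, `isTree_induce_fixed_of_invertedEdges_eq_empty`
import HarnessLib

/-!
# A colour-preserving (or order-preserving) self-map stabilising an edge fixes both ends: «no inversion», the set-stabiliser of an edge is the
# pointwise stabiliser (Serre, *Trees*, I.3.1; Meier, *Groups, Graphs and Trees*, Cor. 3.47; Schneider–Stuhler 1997, III.4)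

Topic `Combinatorics/SimpleGraph`; namespace `Literature.Combinatorics.SimpleGraph.NoInversion`.  THEOREMS ONLY (no definition, no instance, no notation, no
named fact, no `sorry`), for ARBITRARY vertex types; Mathlib + ★ `TreeAutomorphismFixedPoints` (finite-tree corollaries of §5 only).

An INVERSION of an edge `{x, y}` by a self-map `φ` is `φ x = y ∧ φ y = x` (Serre I.3.1 «une inversion est un couple `g ∈ G`, `y ∈ arête Y` tel que `g y = ȳ`»).  Two
elementary obstructions, each sufficient: (C) a COLOURING `c` with `c (φ x) = c x`, `c (φ y) = c y` and `c x ≠ c y` (Meier Cor. 3.47: an inverted edge would join two vertices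
of the same colour — the bipartite ∕ TYPE-PRESERVING case of buildings); (O) an ORDER with `x < y` and `φ x < φ y` (lattice models: vertices are lattices, adjacency is strict
inclusion, the group acts by inclusion-preserving maps).  Under either, `φ` maps `{x, y}` into itself only by fixing `x` and `y`; for a group action the set-stabiliser
`Stab {x, y}` is `Stab x ⊓ Stab y` — in the language of the oriented cellular chain complex of a building ([SchneiderStuhler1997, III.4]: `P_F† ⊇ P_F`, orientation character
`ε_F : P_F† → {±1}`) this is «`P_F† = P_F`, `ε_F = 1`» for every edge `F`.  Consumer: the Bruhat–Tits tree of a `p`-adic unitary group in three variables (cell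
`pub/hodgecm-mathlib`, crux H413 = stmt-HodgeConjecture-24833, census «E1» §2-K1 (T)), model instance ★ `Literature/NumberTheory/Automorphic/UnitaryLatticeTreeNoInversion`.

* §1 two-point sets: `apply_eq_of_mapsTo_pair` (`φ x ≠ y`, `φ y ≠ x`), `…_of_apply_ne` (C), `…_of_lt` (O); image forms `image_pair_eq_iff_of_apply_ne ∕ _of_lt`.
* §2 unordered pairs: `sym2Map_mk_eq_iff` (`Sym2.map φ s(x, y) = s(x, y) ↔ φ x = x ∧ φ y = y` as soon as `φ x ≠ y`), `…_of_apply_ne`, `…_of_lt`.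
* §3 group actions: `stabilizer_inf_stabilizer_le_stabilizer_pair` (always), `mem_stabilizer_pair_iff_of_forall_smul_ne` ∕ **`stabilizer_pair_eq_inf_of_forall_smul_ne`**
  (`y ∉ G·x`), `stabilizer_pair_eq_inf_of_invariant` (C: a `G`-invariant colouring separating `x` and `y`), `mem_stabilizer_pair_iff_of_lt` ∕ `stabilizer_pair_eq_inf_of_lt` (O).
* §4 simple graphs: **`apply_eq_of_sym2Map_eq_of_coloring`** — a self-map preserving a proper colouring and stabilising an edge `s(x, y)` fixes `x` and `y`;
  `forall_apply_eq_of_sym2Map_eq_of_coloring` (edge-set form), `apply_eq_of_mapEdgeSet_eq_of_coloring` (graph homomorphisms ∕ automorphisms).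
* §5 finite trees (★ `invertedEdges`): `invertedEdges_eq_empty_of_coloring`, `card_fixedVertices_eq_of_coloring` (`#Fix = #FixEdges + 1`), `isTree_induce_fixed_of_coloring`.

## References
* [Serre1980Trees] J.-P. Serre, *Trees* (1980), Ch. I §3.1 (inversions; actions without inversion), §6.1.
* [Meier2008] J. Meier, *Groups, Graphs and Trees* (2008), Corollary 3.47 (a colour-preserving automorphism inverts no edge).
* [SchneiderStuhler1997] P. Schneider, U. Stuhler, *Representation theory and sheaves on the Bruhat–Tits building*, Publ. Math. IHÉS 85 (1997), III.4 (`P_F†`, `ε_F`).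
-/

set_option autoImplicit false

open Set SimpleGraph

namespace Literature.Combinatorics.SimpleGraph.NoInversion

/-! ## §1 Two-point sets: a self-map that cannot exchange `x` and `y` fixes both -/

section Pair

variable {α : Type*} (φ : α → α) {x y : α}

/-- A self-map sending `{x, y}` into itself with `φ x ≠ y` and `φ y ≠ x` fixes `x` and `y`. [cite: Serre1980Trees, I.3.1] -/
theorem apply_eq_of_mapsTo_pair (h : MapsTo φ {x, y} {x, y}) (hx : φ x ≠ y) (hy : φ y ≠ x) : φ x = x ∧ φ y = y := by
  have h1 := h (mem_insert x {y})
  have h2 := h (mem_insert_of_mem x (mem_singleton y))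
  simp only [mem_insert_iff, mem_singleton_iff] at h1 h2
  exact ⟨h1.resolve_right hx, h2.resolve_left hy⟩

/-- **(C) COLOUR OBSTRUCTION.**  If `φ` preserves the colours of `x` and `y` and these colours differ, then `φ` maps `{x, y}` into itself only by fixing `x` and `y`
(an inversion would join two points of the same colour). [cite: Meier2008, Corollary 3.47] -/
theorem apply_eq_of_mapsTo_pair_of_apply_ne {ι : Type*} (c : α → ι) (hcx : c (φ x) = c x) (hcy : c (φ y) = c y) (hxy : c x ≠ c y)
    (h : MapsTo φ {x, y} {x, y}) : φ x = x ∧ φ y = y :=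
  apply_eq_of_mapsTo_pair φ h (fun e => hxy (hcx.symm.trans (congrArg c e))) (fun e => hxy (hcy.symm.trans (congrArg c e)).symm)

/-- **(O) ORDER OBSTRUCTION.**  If `x < y` and `φ x < φ y`, then `φ` maps `{x, y}` into itself only by fixing `x` and `y`. [cite: Serre1980Trees, I.3.1] -/
theorem apply_eq_of_mapsTo_pair_of_lt [Preorder α] (hφ : φ x < φ y) (hxy : x < y) (h : MapsTo φ {x, y} {x, y}) : φ x = x ∧ φ y = y := by
  have h1 := h (mem_insert x {y})
  have h2 := h (mem_insert_of_mem x (mem_singleton y))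
  simp only [mem_insert_iff, mem_singleton_iff] at h1 h2
  rcases h1 with h1 | h1
  · refine ⟨h1, h2.resolve_left fun h2 => ?_⟩
    rw [h1, h2] at hφ
    exact lt_irrefl _ hφ
  · exfalso
    rcases h2 with h2 | h2
    · rw [h1, h2] at hφ
      exact lt_asymm hxy hφ
    · rw [h1, h2] at hφ
      exact lt_irrefl _ hφ

/-- Image form of (C): `φ '' {x, y} = {x, y} ↔ φ x = x ∧ φ y = y`. [cite: Meier2008, Corollary 3.47] -/
theorem image_pair_eq_iff_of_apply_ne {ι : Type*} (c : α → ι) (hcx : c (φ x) = c x) (hcy : c (φ y) = c y) (hxy : c x ≠ c y) :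
    φ '' {x, y} = {x, y} ↔ φ x = x ∧ φ y = y := by
  refine ⟨fun h => apply_eq_of_mapsTo_pair_of_apply_ne φ c hcx hcy hxy (mapsTo_iff_image_subset.2 h.le), ?_⟩
  rintro ⟨hx, hy⟩
  rw [image_pair, hx, hy]

/-- Image form of (O): for `x < y` and `φ x < φ y`, `φ '' {x, y} = {x, y} ↔ φ x = x ∧ φ y = y`. [cite: Serre1980Trees, I.3.1] -/
theorem image_pair_eq_iff_of_lt [Preorder α] (hφ : φ x < φ y) (hxy : x < y) : φ '' {x, y} = {x, y} ↔ φ x = x ∧ φ y = y := by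
  refine ⟨fun h => apply_eq_of_mapsTo_pair_of_lt φ hφ hxy (mapsTo_iff_image_subset.2 h.le), ?_⟩
  rintro ⟨hx, hy⟩
  rw [image_pair, hx, hy]

end Pair

/-! ## §2 Unordered pairs `s(x, y)` -/

section Sym2

variable {α : Type*} (φ : α → α) {x y : α}

/-- `φ` stabilises the unordered pair `s(x, y)` iff it fixes or exchanges the ends; if `φ x ≠ y` it fixes both. [cite: Serre1980Trees, I.3.1] -/
theorem sym2Map_mk_eq_iff (hx : φ x ≠ y) : Sym2.map φ s(x, y) = s(x, y) ↔ φ x = x ∧ φ y = y := by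
  rw [Sym2.map_mk, Sym2.eq_iff]
  exact ⟨fun h => h.resolve_right fun h' => hx h'.1, Or.inl⟩

/-- (C) for unordered pairs. [cite: Meier2008, Corollary 3.47] -/
theorem sym2Map_mk_eq_iff_of_apply_ne {ι : Type*} (c : α → ι) (hcx : c (φ x) = c x) (hxy : c x ≠ c y) :
    Sym2.map φ s(x, y) = s(x, y) ↔ φ x = x ∧ φ y = y :=
  sym2Map_mk_eq_iff φ fun e => hxy (hcx.symm.trans (congrArg c e))

/-- (O) for unordered pairs: `x < y`, `φ x < φ y`. [cite: Serre1980Trees, I.3.1] -/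
theorem sym2Map_mk_eq_iff_of_lt [Preorder α] (hφ : φ x < φ y) (hxy : x < y) : Sym2.map φ s(x, y) = s(x, y) ↔ φ x = x ∧ φ y = y := by
  rw [Sym2.map_mk, Sym2.eq_iff]
  refine ⟨fun h => h.resolve_right fun h' => ?_, Or.inl⟩
  rw [h'.1, h'.2] at hφ
  exact lt_asymm hxy hφ

end Sym2

/-! ## §3 Group actions: the set-stabiliser of `{x, y}` versus `Stab x ⊓ Stab y` -/

section Action

open MulAction
open scoped Pointwise

variable {G α : Type*} [Group G] [MulAction G α] {x y : α}

/-- `Stab x ⊓ Stab y ≤ Stab {x, y}` (always). [cite: SchneiderStuhler1997, III.4] -/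
theorem stabilizer_inf_stabilizer_le_stabilizer_pair : stabilizer G x ⊓ stabilizer G y ≤ stabilizer G ({x, y} : Set α) := by
  intro g hg
  rw [Subgroup.mem_inf, mem_stabilizer_iff, mem_stabilizer_iff] at hg
  rw [mem_stabilizer_iff, smul_set_insert, smul_set_singleton, hg.1, hg.2]

/-- If `y` is not in the orbit of `x`, an element stabilising `{x, y}` fixes `x` and `y`. [cite: Serre1980Trees, I.3.1] -/
theorem mem_stabilizer_pair_iff_of_forall_smul_ne (h : ∀ g : G, g • x ≠ y) (g : G) : g ∈ stabilizer G ({x, y} : Set α) ↔ g • x = x ∧ g • y = y := by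
  refine ⟨fun hg => ?_, fun hg => stabilizer_inf_stabilizer_le_stabilizer_pair (Subgroup.mem_inf.2 ⟨mem_stabilizer_iff.2 hg.1, mem_stabilizer_iff.2 hg.2⟩)⟩
  rw [mem_stabilizer_iff, smul_set_insert, smul_set_singleton] at hg
  refine apply_eq_of_mapsTo_pair (fun a => g • a) (mapsTo_iff_image_subset.2 ?_) (h g) fun e => h g⁻¹ ?_
  · rw [image_pair]
    exact hg.le
  · rw [← e, inv_smul_smul]

/-- **`Stab {x, y} = Stab x ⊓ Stab y` when `y ∉ G · x`** — the set-stabiliser of an edge whose ends lie in different orbits is its pointwise stabiliser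
(`P_F† = P_F`, `ε_F = 1`). [cite: SchneiderStuhler1997, III.4] [cite: Serre1980Trees, I.3.1] -/
theorem stabilizer_pair_eq_inf_of_forall_smul_ne (h : ∀ g : G, g • x ≠ y) : stabilizer G ({x, y} : Set α) = stabilizer G x ⊓ stabilizer G y := by
  ext g
  rw [mem_stabilizer_pair_iff_of_forall_smul_ne h, Subgroup.mem_inf, mem_stabilizer_iff, mem_stabilizer_iff]

/-- **(C) TYPE-PRESERVING ACTIONS**: if `G` preserves a colouring `c` (`c (g • a) = c a`) and `c x ≠ c y`, then `Stab {x, y} = Stab x ⊓ Stab y`. [cite: Meier2008, Corollary 3.47]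
[cite: SchneiderStuhler1997, III.4] -/
theorem stabilizer_pair_eq_inf_of_invariant {ι : Type*} (c : α → ι) (hc : ∀ (g : G) (a : α), c (g • a) = c a) (hxy : c x ≠ c y) :
    stabilizer G ({x, y} : Set α) = stabilizer G x ⊓ stabilizer G y :=
  stabilizer_pair_eq_inf_of_forall_smul_ne fun g e => hxy ((hc g x).symm.trans (congrArg c e))

/-- **(O) ORDER-PRESERVING ACTIONS**: if every `g` is strictly monotone at `(x, y)` and `x < y`, an element stabilising `{x, y}` fixes `x` and `y`. [cite: Serre1980Trees, I.3.1] -/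
theorem mem_stabilizer_pair_iff_of_lt [Preorder α] (hmono : ∀ g : G, g • x < g • y) (hxy : x < y) (g : G) :
    g ∈ stabilizer G ({x, y} : Set α) ↔ g • x = x ∧ g • y = y := by
  refine ⟨fun hg => ?_, fun hg => stabilizer_inf_stabilizer_le_stabilizer_pair (Subgroup.mem_inf.2 ⟨mem_stabilizer_iff.2 hg.1, mem_stabilizer_iff.2 hg.2⟩)⟩
  rw [mem_stabilizer_iff, smul_set_insert, smul_set_singleton] at hg
  refine apply_eq_of_mapsTo_pair_of_lt (fun a => g • a) (hmono g) hxy (mapsTo_iff_image_subset.2 ?_)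
  rw [image_pair]
  exact hg.le

/-- (O): `Stab {x, y} = Stab x ⊓ Stab y` for `x < y` under an order-preserving action. [cite: Serre1980Trees, I.3.1] [cite: SchneiderStuhler1997, III.4] -/
theorem stabilizer_pair_eq_inf_of_lt [Preorder α] (hmono : ∀ g : G, g • x < g • y) (hxy : x < y) :
    stabilizer G ({x, y} : Set α) = stabilizer G x ⊓ stabilizer G y := by
  ext g
  rw [mem_stabilizer_pair_iff_of_lt hmono hxy, Subgroup.mem_inf, mem_stabilizer_iff, mem_stabilizer_iff]

end Action

/-! ## §4 Simple graphs: a colour-preserving map stabilising an edge fixes its ends -/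

section Graph

variable {V : Type*} {G : SimpleGraph V} {ι : Type*}

/-- **NO INVERSION UNDER A PRESERVED PROPER COLOURING.**  If `φ : V → V` preserves a proper colouring `C` of `G` and stabilises the edge `s(x, y)` (`G.Adj x y`), then
`φ x = x` and `φ y = y`. [cite: Meier2008, Corollary 3.47] [cite: Serre1980Trees, I.3.1] -/
theorem apply_eq_of_sym2Map_eq_of_coloring (C : G.Coloring ι) (φ : V → V) (hC : ∀ v, C (φ v) = C v) {x y : V} (hadj : G.Adj x y)
    (h : Sym2.map φ s(x, y) = s(x, y)) : φ x = x ∧ φ y = y :=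
  (sym2Map_mk_eq_iff_of_apply_ne φ C (hC x) (C.valid hadj)).1 h

/-- The `iff` form: a colour-preserving `φ` stabilises the edge `s(x, y)` iff it fixes `x` and `y`. [cite: Meier2008, Corollary 3.47] -/
theorem sym2Map_eq_iff_of_coloring (C : G.Coloring ι) (φ : V → V) (hC : ∀ v, C (φ v) = C v) {x y : V} (hadj : G.Adj x y) :
    Sym2.map φ s(x, y) = s(x, y) ↔ φ x = x ∧ φ y = y :=
  sym2Map_mk_eq_iff_of_apply_ne φ C (hC x) (C.valid hadj)

/-- Edge-set form: a colour-preserving `φ` fixes pointwise every edge it stabilises. [cite: Meier2008, Corollary 3.47] [cite: Serre1980Trees, I.3.1] -/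
theorem forall_apply_eq_of_sym2Map_eq_of_coloring (C : G.Coloring ι) (φ : V → V) (hC : ∀ v, C (φ v) = C v) {e : Sym2 V} (he : e ∈ G.edgeSet)
    (h : Sym2.map φ e = e) : ∀ v ∈ e, φ v = v := by
  induction e using Sym2.ind with
  | h x y =>
    obtain ⟨hx, hy⟩ := apply_eq_of_sym2Map_eq_of_coloring C φ hC ((mem_edgeSet G).1 he) h
    intro v hv
    rcases Sym2.mem_iff.1 hv with rfl | rfl
    exacts [hx, hy]

/-- Homomorphism form (in particular for automorphisms `G ≃g G`): a colour-preserving `f : G →g G` with `f.mapEdgeSet e = e` fixes both ends of `e`.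
[cite: Meier2008, Corollary 3.47] -/
theorem apply_eq_of_mapEdgeSet_eq_of_coloring (C : G.Coloring ι) (f : G →g G) (hC : ∀ v, C (f v) = C v) {e : G.edgeSet} (h : f.mapEdgeSet e = e) :
    ∀ v ∈ (e : Sym2 V), f v = v :=
  forall_apply_eq_of_sym2Map_eq_of_coloring C f hC e.2 (congrArg Subtype.val h)

end Graph

/-! ## §5 Finite trees: a colour-preserving automorphism inverts no edge -/

section FiniteTree

open Finset Literature.Combinatorics.SimpleGraph.BakerNorine Literature.Combinatorics.SimpleGraph.OrientedIncidence

variable {V : Type*} [Fintype V] [DecidableEq V] {G : SimpleGraph V} [DecidableRel G.Adj] {ι : Type*}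

/-- A colour-preserving automorphism of a finite graph has no inverted edge (★ `invertedEdges`). [cite: Meier2008, Corollary 3.47] -/
theorem invertedEdges_eq_empty_of_coloring (α : G ≃g G) (C : G.Coloring ι) (hC : ∀ v, C (α v) = C v) : invertedEdges α = ∅ := by
  rw [Finset.eq_empty_iff_forall_notMem]
  intro e he
  rw [mem_invertedEdges_iff (someOrientation G)] at he
  exact C.valid ((someOrientation G).adj_head_tail e) ((hC _).symm.trans (congrArg C he.1))

/-- For a colour-preserving automorphism of a finite tree, `#{fixed vertices} = #{fixed edges} + 1` (★ `card_fixedVertices_eq_of_invertedEdges_eq_empty`).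
[cite: Meier2008, Corollary 3.47, Lemma 3.50] -/
theorem card_fixedVertices_eq_of_coloring (hT : G.IsTree) (α : G ≃g G) (C : G.Coloring ι) (hC : ∀ v, C (α v) = C v) :
    (fixedVertices α).card = (fixedEdges α).card + 1 :=
  card_fixedVertices_eq_of_invertedEdges_eq_empty hT α (invertedEdges_eq_empty_of_coloring α C hC)

/-- For a colour-preserving automorphism of a finite tree, the fixed vertices induce a subtree (★ `isTree_induce_fixed_of_invertedEdges_eq_empty`).
[cite: Meier2008, Corollary 3.47, Lemma 3.50] -/
theorem isTree_induce_fixed_of_coloring (hT : G.IsTree) (α : G ≃g G) (C : G.Coloring ι) (hC : ∀ v, C (α v) = C v) :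
    (G.induce {v | α v = v}).IsTree :=
  isTree_induce_fixed_of_invertedEdges_eq_empty hT α (invertedEdges_eq_empty_of_coloring α C hC)

end FiniteTree

end Literature.Combinatorics.SimpleGraph.NoInversion
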